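import Literature.AlgebraicGeometry.HodgeTheory.WeilClassesFieldHodgeOfNoTypeIVFactor
import Literature.AlgebraicGeometry.HodgeTheory.AbelianVarietyHOneExactness
import Literature.AlgebraicGeometry.ComplexMultiplication.CMTypeOfSimpleSubvariety
import Mathlib.RingTheory.SimpleModule.IsAlgClosed
import Mathlib.Data.Matrix.Basis
import HarnessLib

/-!
# On a simple abelian variety whose endomorphism algebra is NON-COMMUTATIVE of degree `≤ 8` every multiplicity of a CENTRAL endomorphism on `H^{1,0}` is EVEN

UNCONDITIONAL. Theorems only — no definition, no named fact, no `sorry`. No case of the Hodge conjecture is claimed.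

PURPOSE. The Summits-side companion `Ring2/NonCMFivefoldsCodimTwoResidual` localises the fivefold fact
`MoonenZarhin1999_codimTwoHodgeClasses_abelianFivefold` to three NON-CM Albert cells; its cell (γ) (Moonen–Zarhin 1999
Thm. 0.2 (3), case (g) with `End⁰(X₂) ⊋ k`) lists, next to the quartic-field alternative, the alternative
«`[End⁰(F):ℚ] = 8` with centre of degree `2`» (a quaternion algebra over `k = ℚ(φ)`) for a SIMPLE fourfold `F` carrying a
CENTRAL `φ`, `φ ≫ φ = -n`, acting on `H^{1,0}(F)` with UNBALANCED multiplicities — `(1,3)` by Shimura (the tree's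
`AbelianVariety.eigenMultiplicity_pos_of_isSimple`).  This file proves the representation-theoretic remark that empties
that alternative: a quaternion algebra over the centre forces EVEN multiplicities (the `d = 2` instance of «the centre
`K` of an algebra of Type IV(e₀, d) acts on the tangent space with multiplicities `d·r_ν, d·s_ν`»).

THE ARGUMENT (ours, assembled from cited ingredients; no printed proof is followed).  Let `D = End⁰(A)` act on
`H¹ = H¹(A(ℂ); ℂ)` by pull-backs and let `E″ ⊆ End_ℂ H¹` be the `ℂ`-span of the pull-backs (Milne's bicommutant
`(C(A) ⊗ ℂ)′`, the tree's `Milne1999.bicommutant`; a finite-dimensional SEMISIMPLE `ℂ`-algebra by the tree's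
`Milne1999.isSemisimpleRing_bicommutant`, Poincaré + base change).  Wedderburn–Artin over `ℂ` (Mathlib
`IsSemisimpleRing.exists_algEquiv_pi_matrix_of_isAlgClosed`): `E″ ≅ Πᵢ M_{dᵢ}(ℂ)`.
* `Σᵢ dᵢ² = dim_ℂ E″ ≤ dim_ℚ D ≤ 8`: `E″` is the image of `ℂ ⊗_ℚ D` (the tree's `exists_complexEndAlgebraRep_eq`).
* no `dᵢ = 1`: a block of size `1` is a `ℂ`-algebra map `χ : E″ → M₁(ℂ)`; composed with `a ↦ a^*` it gives a unital
  anti-multiplicative additive map `D → M₁(ℂ)` into a COMMUTATIVE ring, injective because `D` is a division algebra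
  (`A` simple; Mumford §19 Cor. 2, the tree's `endAlgebra_exists_inv_of_isSimple`), whence `D` is commutative —
  excluded by hypothesis (`Z(D) ≠ D`).
* hence every `dᵢ = 2` (`dᵢ ≥ 3` would give `dᵢ² ≥ 9 > 8`), `E″ ≅ Πᵢ M₂(ℂ)` receives the diagonal matrix units
  `p = (e₁₁)ᵢ, q = (e₂₂)ᵢ, s = (e₂₁)ᵢ, t = (e₁₂)ᵢ` with `p + q = 1, p² = p, ts = p, st = q, pt = t, ps = 0`;
* for `φ` CENTRAL in `End(A)` the pull-back `φ^*` lies in Milne's `C(A) ⊗ ℂ`, so every `X ∈ E″` commutes with `φ^*`;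
  every `X ∈ E″` preserves `H^{1,0}` (the tree's `map_mem_hodgeOneZero_of_mem_bicommutant`); so `W = V_ρ ∩ H^{1,0}`
  (`V_ρ = ker(φ^* − ρ)`) is stable under `p, s, t`, and `t : ker(p|_W) ⥲ im(p|_W)` (inverse `s`) with rank–nullity
  gives `dim W = 2 · dim im(p|_W)` — i.e. `n_ρ(φ) = eigenMultiplicity A φ ρ` is EVEN.

WHAT IS PROVED (theorems; §1–§3 are generic plumbing, `private` where they carry no mathematics of their own).
* §1 matrix units in `Π_i M₂(ℂ)` (private).
* §2 `exists_matrixUnits_of_finrank_le_eight` — a finite-dimensional semisimple `ℂ`-algebra of dimension `≤ 8` without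
  `ℂ`-algebra maps to `M₁(ℂ)` contains `p, q, s, t` as above.
* §3 `even_finrank_of_matrixUnits` — a subspace stable under such `p, s, t` (acting on an ambient space) is
  even-dimensional.
* §4 `finrank_bicommutant_le_finrank_endAlgebra` (`dim_ℂ E″ ≤ dim_ℚ End⁰(A)`), `center_eq_top_of_algHom_bicommutant_matrix_one`
  (a size-one block of `E″` forces `End⁰(A)` commutative, `A` simple), **`even_eigenMultiplicity_of_isSimple_of_finrank_le_eight`**
  (`A` simple, `dim_ℚ End⁰(A) ≤ 8`, `Z(End⁰ A) ≠ End⁰(A)`, `φ` commuting with `End(A)` ⟹ `n_ρ(φ)` even for every `ρ`),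
  `…_of_mem_center` (the same with `φ` central in `End⁰(A)`), **`even_eigenMultiplicity_of_isSimple_of_finrank_eq_eight_of_finrank_center_eq_two`**
  (the shape of cell (γ): `[End⁰(A):ℚ] = 8`, `[Z:ℚ] = 2`).

WHAT IS NOT CLAIMED: nothing on which algebras occur as `End⁰` (Shimura's existence/non-existence results are not used or
proved); no statement for `d ≥ 3`; nothing on Hodge classes.  No `sorry`; axioms `propext`, `Classical.choice`, `Quot.sound`.

## References
* [MumfordAV1970] D. Mumford, *Abelian Varieties* (1970), §19 Cor. 2 of Thm. 1 (p. 174) (`End⁰` of a simple abelian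
  variety is a division algebra), §19 Thm. 3 (`End ⊂ End⁰`), §21 (Albert types; `[D:K] = d²`).
* [Milne1999LefschetzClasses] J. S. Milne, *Lefschetz classes on abelian varieties*, Duke Math. J. 96 (1999), §1 p. 642,
  Remark 1.2 (p. 643), §2 p. 645 (`C(A)`, `E ⊗ k` semisimple).
* [MoonenZarhin1999LowDim] B. Moonen, Yu. Zarhin, Math. Ann. 315 (1999), §1 (1.1) (Albert's classification, Type IV(e₀,d):
  «`D` is a division algebra of rank `d²` over `F`»), §5 (5.11) Case 2 and Thm. 0.2 (3) case (g) (multiplicities `(1,3)`).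
* [Shimura1963AnalyticFamilies] G. Shimura, Ann. of Math. 78 (1963) (multiplicities of Type IV actions; cited through
  Moonen–Zarhin 1999 §2 and Hulek–Laface, arXiv:1703.05882 Prop. 5.1, held).

Provenance: Literature home (family `hodge`, namespace `Literature.AlgebraicGeometry.HodgeTheory.EndAlgebraDegreeEightEvenMultiplicity`) of the Summits-side `Summits/HodgeConjecture/Ring2/EndAlgebraDegreeEightEvenMultiplicity` (cell `pub-hodge-ring2`, seat `lit` gen 65; all its imports are `Literature/` and Mathlib), which `Literature/` may not import; theorems only, no named fact, no definition. Nothing here bears on `HC_CM`; no case of the Hodge conjecture is proved. Lane `lit-hodgefound` (Layer A3: endomorphism algebras of simple abelian varieties acting on `H^{1,0}`), seat p20.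
-/

noncomputable section

open scoped TensorProduct
open _root_.CategoryTheory

namespace Literature.AlgebraicGeometry.HodgeTheory.EndAlgebraDegreeEightEvenMultiplicity

/-! ### §1 Matrix units in `Πᵢ M₂(ℂ)` -/

section MatrixUnits

variable {n : ℕ}

/-- `(e_ab)ᵢ · (e_bc)ᵢ = (e_ac)ᵢ`. [cite: MoonenZarhin1999LowDim, Thm. 0.2 (3) case (g)] -/
private theorem piSingle_mul_piSingle_same (a b c : Fin 2) :
    ((fun _ : Fin n => Matrix.single a b (1 : ℂ)) * fun _ => Matrix.single b c (1 : ℂ)) =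
      fun _ => Matrix.single a c (1 : ℂ) := by
  funext i
  rw [Pi.mul_apply, Matrix.single_mul_single_same, mul_one]

/-- `(e_ab)ᵢ · (e_b'c)ᵢ = 0` for `b ≠ b'`. [cite: MoonenZarhin1999LowDim, Thm. 0.2 (3) case (g)] -/
private theorem piSingle_mul_piSingle_of_ne {a b b' c : Fin 2} (h : b ≠ b') :
    ((fun _ : Fin n => Matrix.single a b (1 : ℂ)) * fun _ => Matrix.single b' c (1 : ℂ)) = 0 := by
  funext i
  rw [Pi.mul_apply, Pi.zero_apply]
  exact Matrix.single_mul_single_of_ne _ _ _ _ h _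

/-- `(e₁₁)ᵢ + (e₂₂)ᵢ = 1`. [cite: MoonenZarhin1999LowDim, Thm. 0.2 (3) case (g)] -/
private theorem piSingle_add_piSingle :
    ((fun _ : Fin n => Matrix.single (0 : Fin 2) (0 : Fin 2) (1 : ℂ)) +
        fun _ => Matrix.single (1 : Fin 2) (1 : Fin 2) (1 : ℂ)) = 1 := by
  funext i
  rw [Pi.add_apply, Pi.one_apply]
  ext j k
  fin_cases j <;> fin_cases k <;> simp [Matrix.single]

/-- `M₁(ℂ)` is commutative. [cite: MoonenZarhin1999LowDim, Thm. 0.2 (3) case (g)] -/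
private theorem matrix_one_mul_comm (x y : Matrix (Fin 1) (Fin 1) ℂ) : x * y = y * x := by
  ext i j
  fin_cases i; fin_cases j
  simp [Matrix.mul_apply, mul_comm]

end MatrixUnits

/-! ### §2 Blocks of a semisimple `ℂ`-algebra of dimension `≤ 8` without one-dimensional blocks -/

section Engine

variable {R : Type*} [Ring R] [Algebra ℂ R]

/-- **Matrix units from Wedderburn–Artin.** A finite-dimensional semisimple `ℂ`-algebra `R` of dimension `≤ 8`
admitting no `ℂ`-algebra homomorphism to `M₁(ℂ)` is `≅ Πᵢ M₂(ℂ)` and therefore contains `p, q, s, t` with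
`p + q = 1`, `p² = p`, `t s = p`, `s t = q`, `p t = t`, `p s = 0` (the diagonal matrix units
`(e₁₁)ᵢ, (e₂₂)ᵢ, (e₂₁)ᵢ, (e₁₂)ᵢ`). [cite: MoonenZarhin1999LowDim, Thm. 0.2 (3) case (g)] -/
theorem exists_matrixUnits_of_finrank_le_eight [IsSemisimpleRing R] [FiniteDimensional ℂ R]
    (h8 : Module.finrank ℂ R ≤ 8) (hnc : ∀ _χ : R →ₐ[ℂ] Matrix (Fin 1) (Fin 1) ℂ, False) :
    ∃ p q s t : R, p + q = 1 ∧ p * p = p ∧ t * s = p ∧ s * t = q ∧ p * t = t ∧ p * s = 0 := by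
  obtain ⟨n, d, hd, ⟨e⟩⟩ := IsSemisimpleRing.exists_algEquiv_pi_matrix_of_isAlgClosed ℂ R
  -- every block has size `2`
  have h2 : ∀ i, d i = 2 := by
    intro i
    have hne1 : d i ≠ 1 := fun h1 =>
      hnc ((Matrix.reindexAlgEquiv ℂ ℂ (finCongr h1)).toAlgHom.comp
        ((Pi.evalAlgHom ℂ (fun j => Matrix (Fin (d j)) (Fin (d j)) ℂ) i).comp e.toAlgHom))
    have hsum : Module.finrank ℂ R = ∑ j, d j * d j := by
      rw [e.toLinearEquiv.finrank_eq, Module.finrank_pi_fintype]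
      exact Finset.sum_congr rfl fun j _ => by
        rw [Module.finrank_matrix, Module.finrank_self, mul_one, Fintype.card_fin]
    have hle : d i * d i ≤ ∑ j, d j * d j :=
      Finset.single_le_sum (f := fun j => d j * d j) (fun j _ => Nat.zero_le _) (Finset.mem_univ i)
    have h0 : d i ≠ 0 := (hd i).ne
    have hdi : d i ≤ 2 := by
      by_contra h3
      have h3' : 3 ≤ d i := by omega
      have : 9 ≤ d i * d i := Nat.mul_le_mul h3' h3'
      omega
    omega
  let e' : R ≃ₐ[ℂ] (Fin n → Matrix (Fin 2) (Fin 2) ℂ) :=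
    e.trans (AlgEquiv.piCongrRight fun i => Matrix.reindexAlgEquiv ℂ ℂ (finCongr (h2 i)))
  refine ⟨e'.symm (fun _ => Matrix.single 0 0 1), e'.symm (fun _ => Matrix.single 1 1 1),
    e'.symm (fun _ => Matrix.single 1 0 1), e'.symm (fun _ => Matrix.single 0 1 1), ?_, ?_, ?_, ?_, ?_, ?_⟩
  · rw [← map_add, piSingle_add_piSingle, map_one]
  · rw [← map_mul, piSingle_mul_piSingle_same]
  · rw [← map_mul, piSingle_mul_piSingle_same]
  · rw [← map_mul, piSingle_mul_piSingle_same]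
  · rw [← map_mul, piSingle_mul_piSingle_same]
  · rw [← map_mul, piSingle_mul_piSingle_of_ne (show (0 : Fin 2) ≠ 1 by decide), map_zero]

end Engine

/-! ### §3 A subspace stable under `M₂`-matrix units is even-dimensional -/

section LinearAlgebra

variable {V : Type*} [AddCommGroup V] [Module ℂ V] [FiniteDimensional ℂ V]

/-- **Even dimension.** If `p + q = 1`, `p² = p`, `t s = p`, `s t = q`, `p t = t`, `p s = 0` in `End_ℂ V` and a subspace
`W` is stable under `p, s, t`, then `t : ker(p|_W) ⥲ im(p|_W)` (inverse `s`), so `dim W = 2 · dim im(p|_W)` by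
rank–nullity. [cite: MoonenZarhin1999LowDim, Thm. 0.2 (3) case (g)] -/
theorem even_finrank_of_matrixUnits (W : Submodule ℂ V) {P Q S T : Module.End ℂ V} (hPQ : P + Q = 1)
    (hPP : P * P = P) (hTS : T * S = P) (hST : S * T = Q) (hPT : P * T = T) (hPS : P * S = 0)
    (hP : ∀ w ∈ W, P w ∈ W) (hS : ∀ w ∈ W, S w ∈ W) (hT : ∀ w ∈ W, T w ∈ W) :
    Even (Module.finrank ℂ W) := by
  have ePT : ∀ v, P (T v) = T v := fun v => by rw [← Module.End.mul_apply, hPT]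
  have ePS : ∀ v, P (S v) = 0 := fun v => by rw [← Module.End.mul_apply, hPS, LinearMap.zero_apply]
  have eTS : ∀ v, T (S v) = P v := fun v => by rw [← Module.End.mul_apply, hTS]
  have eST : ∀ v, S (T v) = v - P v := fun v => by
    rw [← Module.End.mul_apply, hST, eq_sub_iff_add_eq, add_comm, ← LinearMap.add_apply, hPQ,
      Module.End.one_apply]
  have ePP : ∀ v, P (P v) = P v := fun v => by rw [← Module.End.mul_apply, hPP]
  set p : W →ₗ[ℂ] W := P.restrict hP with hp
  have hp_coe : ∀ w : W, ((p w : W) : V) = P w := fun w => rfl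
  -- `t : ker p → range p`
  have hT' : ∀ x : LinearMap.ker p, (⟨T (x : W), hT _ (x : W).2⟩ : W) ∈ LinearMap.range p := fun x =>
    ⟨⟨T (x : W), hT _ (x : W).2⟩, Subtype.ext (by rw [hp_coe]; exact ePT _)⟩
  have hS' : ∀ y : LinearMap.range p, (⟨S (y : W), hS _ (y : W).2⟩ : W) ∈ LinearMap.ker p := fun y =>
    LinearMap.mem_ker.2 (Subtype.ext (by rw [hp_coe]; exact ePS _))
  let f : LinearMap.ker p → LinearMap.range p := fun x => ⟨_, hT' x⟩
  let g : LinearMap.range p → LinearMap.ker p := fun y => ⟨_, hS' y⟩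
  have hfg : Function.LeftInverse g f := by
    intro x
    apply Subtype.ext; apply Subtype.ext
    change S (T ((x : W) : V)) = ((x : W) : V)
    have hx : P ((x : W) : V) = 0 := by
      have h0 : (p (x : W) : W) = 0 := LinearMap.mem_ker.1 x.2
      rw [← hp_coe, h0, Submodule.coe_zero]
    rw [eST, hx, sub_zero]
  have hgf : Function.RightInverse g f := by
    intro y
    apply Subtype.ext; apply Subtype.ext
    change T (S ((y : W) : V)) = ((y : W) : V)
    obtain ⟨z, hz⟩ := y.2
    have hy : ((y : W) : V) = P (z : V) := by rw [← hz, hp_coe]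
    rw [eTS, hy, ePP]
  let F : LinearMap.ker p ≃ₗ[ℂ] LinearMap.range p :=
    { toFun := f
      invFun := g
      map_add' := fun x y => by
        apply Subtype.ext; apply Subtype.ext
        change T (((x : W) : V) + ((y : W) : V)) = T ((x : W) : V) + T ((y : W) : V)
        rw [map_add]
      map_smul' := fun c x => by
        apply Subtype.ext; apply Subtype.ext
        change T (c • ((x : W) : V)) = c • T ((x : W) : V)
        rw [map_smul]
      left_inv := hfg
      right_inv := hgf }
  have h := LinearMap.finrank_range_add_finrank_ker p
  rw [← F.finrank_eq] at h
  exact ⟨_, h.symm⟩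

end LinearAlgebra

/-! ### §4 The endomorphism algebra acting on `H¹(A(ℂ); ℂ)` -/

section AbelianVariety

open Literature.AlgebraicTopology.SingularHomology
open Literature.AlgebraicGeometry.Motives
open Literature.AlgebraicGeometry.HodgeTheory
open Literature.AlgebraicGeometry.VanGeemen1994 (pullbackOne)
open Literature.AlgebraicGeometry.Milne1999 (bicommutant centralizerAlgebra mem_centralizerAlgebra_iff
  isSemisimpleRing_bicommutant endAlgebraRepOp unop_endAlgebraRepOp_mem complexEndAlgebraRepOp
  complexEndAlgebraRep exists_complexEndAlgebraRep_eq)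

variable {A : AbelianVariety ℂ}

/-- `(φ ≫ ψ)^* = φ^* ∘ ψ^*` on `H¹(A(ℂ); ℂ)`, in `Module.End`. [cite: MoonenZarhin1999LowDim, Thm. 0.2 (3) case (g)] -/
private theorem pullbackOne_comp (φ ψ : A ⟶ A) : pullbackOne A (φ ≫ ψ) = pullbackOne A φ * pullbackOne A ψ := by
  change (complexBetti.map (φ ≫ ψ).hom.hom.hom 1).hom = _
  rw [complexBetti_map_comp_hom, ModuleCat.hom_comp, Module.End.mul_eq_comp]

/-- An endomorphism commuting with `End(A)` has its pull-back in Milne's `C(A) ⊗ ℂ`.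
[cite: Milne1999LefschetzClasses, §1 p. 642 (definition of C(A))] -/
theorem pullbackOne_mem_centralizerAlgebra_of_forall_comp_eq {φ : A ⟶ A} (hφ : ∀ ψ : A ⟶ A, φ ≫ ψ = ψ ≫ φ) :
    pullbackOne A φ ∈ centralizerAlgebra A :=
  mem_centralizerAlgebra_iff.2 fun ψ => by rw [← pullbackOne_comp, ← hφ, pullbackOne_comp]

/-- Hence every `X ∈ E″ = (C(A) ⊗ ℂ)′` commutes with such a `φ^*`. [cite: Milne1999LefschetzClasses, §1 Remark 1.2 (p. 643)] -/
theorem mul_pullbackOne_eq_of_mem_bicommutant {φ : A ⟶ A} (hφ : ∀ ψ : A ⟶ A, φ ≫ ψ = ψ ≫ φ)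
    {X : Module.End ℂ (complexBetti A.X 1)} (hX : X ∈ bicommutant A) :
    X * pullbackOne A φ = pullbackOne A φ * X :=
  ((Subalgebra.mem_centralizer_iff ℂ).1 hX _ (pullbackOne_mem_centralizerAlgebra_of_forall_comp_eq hφ)).symm

/-- **`dim_ℂ E″ ≤ dim_ℚ End⁰(A)`**: `E″` is the image of `ℂ ⊗_ℚ End⁰(A)` under `z ⊗ a ↦ z a^*`.
[cite: Milne1999LefschetzClasses, §1 Remark 1.2 (p. 643) and §2 p. 645] -/
theorem finrank_bicommutant_le_finrank_endAlgebra :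
    Module.finrank ℂ ↥(bicommutant A) ≤ Module.finrank ℚ A.endAlgebra := by
  haveI := finite_complexBetti_abelianVariety A 1
  let L : ℂ ⊗[ℚ] A.endAlgebra →ₗ[ℂ] Module.End ℂ (complexBetti A.X 1) :=
    (MulOpposite.opLinearEquiv ℂ).symm.toLinearMap ∘ₗ (complexEndAlgebraRepOp A).toLinearMap
  have hle : Subalgebra.toSubmodule (bicommutant A) ≤ LinearMap.range L := by
    intro X hX
    obtain ⟨r, hr⟩ := exists_complexEndAlgebraRep_eq A (show X ∈ bicommutant A from hX)
    refine ⟨MulOpposite.unop r, ?_⟩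
    rw [← hr]
    rfl
  calc Module.finrank ℂ ↥(bicommutant A)
      = Module.finrank ℂ ↥(Subalgebra.toSubmodule (bicommutant A)) := (Subalgebra.finrank_toSubmodule _).symm
    _ ≤ Module.finrank ℂ ↥(LinearMap.range L) := Submodule.finrank_mono hle
    _ ≤ Module.finrank ℂ (ℂ ⊗[ℚ] A.endAlgebra) := LinearMap.finrank_range_le L
    _ = Module.finrank ℚ A.endAlgebra := Module.finrank_baseChange

/-- **A one-dimensional block of `E″` forces `End⁰(A)` commutative** (`A` simple): composing `χ : E″ → M₁(ℂ)` with
`a ↦ a^*` gives a unital, additive, anti-multiplicative map `End⁰(A) → M₁(ℂ)` into a commutative ring, injective since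
`End⁰(A)` is a division algebra (Mumford §19 Cor. 2; the tree's `endAlgebra_exists_inv_of_isSimple`); so
`ab = ba` in `End⁰(A)`. [cite: MumfordAV1970, §19 Cor. 2 of Thm. 1 (p. 174)] [cite: Milne1999LefschetzClasses, §1 p. 642] -/
theorem center_eq_top_of_algHom_bicommutant_matrix_one (hAs : A.IsSimple)
    (χ : ↥(bicommutant A) →ₐ[ℂ] Matrix (Fin 1) (Fin 1) ℂ) : Subalgebra.center ℚ A.endAlgebra = ⊤ := by
  let f : A.endAlgebra → Matrix (Fin 1) (Fin 1) ℂ := fun a =>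
    χ ⟨MulOpposite.unop (endAlgebraRepOp A a), unop_endAlgebraRepOp_mem A a⟩
  have fmul : ∀ a b, f (a * b) = f b * f a := by
    intro a b
    change χ _ = χ _ * χ _
    rw [← map_mul]
    congr 1
    apply Subtype.ext
    change MulOpposite.unop (endAlgebraRepOp A (a * b)) = _
    rw [map_mul, MulOpposite.unop_mul]
    rfl
  have fsub : ∀ a b, f (a - b) = f a - f b := by
    intro a b
    change χ _ = χ _ - χ _
    rw [← map_sub]
    congr 1
    apply Subtype.ext
    change MulOpposite.unop (endAlgebraRepOp A (a - b)) = _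
    rw [map_sub, MulOpposite.unop_sub]
    rfl
  have fone : f 1 = 1 := by
    change χ _ = 1
    rw [← map_one χ]
    congr 1
    apply Subtype.ext
    change MulOpposite.unop (endAlgebraRepOp A 1) = _
    rw [map_one, MulOpposite.unop_one]
    rfl
  have finj : ∀ a, f a = 0 → a = 0 := by
    intro a ha
    by_contra hne
    obtain ⟨y, hy, -⟩ := Literature.AlgebraicGeometry.ComplexMultiplication.endAlgebra_exists_inv_of_isSimple hAs a hne
    have h1 : f 1 = 0 := by rw [← hy, fmul, ha, mul_zero]
    rw [fone] at h1
    exact one_ne_zero h1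
  rw [eq_top_iff]
  intro b _
  rw [Subalgebra.mem_center_iff]
  intro a
  have h := finj (a * b - b * a) (by rw [fsub, fmul, fmul, matrix_one_mul_comm, sub_self])
  exact sub_eq_zero.1 h

/-- **EVEN MULTIPLICITIES.** Let `A` be a SIMPLE complex abelian variety whose endomorphism algebra `End⁰(A)` is
NON-COMMUTATIVE of degree `≤ 8` over `ℚ` (so a quaternion algebra over its centre, `[D:Z(D)] = 4`), and let `φ` commute
with every endomorphism of `A`. Then for every `ρ ∈ ℂ` the multiplicity
`n_ρ(φ) = dim_ℂ (ker(φ^* − ρ) ∩ H^{1,0}(A)) = eigenMultiplicity A φ ρ` is EVEN: `ker(φ^* − ρ) ∩ H^{1,0}` is a module over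
`E″ ≅ Πᵢ M₂(ℂ)`. [cite: MumfordAV1970, §19 Cor. 2 of Thm. 1 (p. 174) and §21 (p. 202)]
[cite: Milne1999LefschetzClasses, §1 Remark 1.2 (p. 643) and §2 p. 645] [cite: MoonenZarhin1999LowDim, §1 (1.1)] -/
theorem even_eigenMultiplicity_of_isSimple_of_finrank_le_eight (hAs : A.IsSimple)
    (h8 : Module.finrank ℚ A.endAlgebra ≤ 8) (hZ : Subalgebra.center ℚ A.endAlgebra ≠ ⊤) {φ : A ⟶ A}
    (hφ : ∀ ψ : A ⟶ A, φ ≫ ψ = ψ ≫ φ) (ρ : ℂ) : Even (eigenMultiplicity A φ ρ) := by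
  haveI := finite_complexBetti_abelianVariety A 1
  haveI : IsSemisimpleRing ↥(bicommutant A) := isSemisimpleRing_bicommutant A
  haveI : FiniteDimensional ℂ ↥(bicommutant A) :=
    FiniteDimensional.of_injective (bicommutant A).val.toLinearMap Subtype.val_injective
  obtain ⟨p, q, s, t, hpq, hpp, hts, hst, hpt, hps⟩ :=
    exists_matrixUnits_of_finrank_le_eight (R := ↥(bicommutant A))
      (finrank_bicommutant_le_finrank_endAlgebra.trans h8)
      fun χ => hZ (center_eq_top_of_algHom_bicommutant_matrix_one hAs χ)
  have hA : IsSmoothProjective A.dim A.X := AbelianVariety.isSmoothProjective_holds (A := A)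
  -- the carrier `W = ker(φ^* - ρ) ∩ H^{1,0}` is stable under every `X ∈ E″`
  have hstab : ∀ X : ↥(bicommutant A), ∀ w ∈ Module.End.eigenspace (pullbackOne A φ) ρ ⊓ hodgeOneZero hA,
      (X : Module.End ℂ (complexBetti A.X 1)) w ∈ Module.End.eigenspace (pullbackOne A φ) ρ ⊓ hodgeOneZero hA := by
    intro X w hw
    refine ⟨?_, map_mem_hodgeOneZero_of_mem_bicommutant hA X.2 hw.2⟩
    have h1 := Module.End.mem_eigenspace_iff.1 hw.1
    rw [SetLike.mem_coe, Module.End.mem_eigenspace_iff, ← Module.End.mul_apply,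
      ← mul_pullbackOne_eq_of_mem_bicommutant hφ X.2, Module.End.mul_apply, h1, map_smul]
  have := even_finrank_of_matrixUnits (Module.End.eigenspace (pullbackOne A φ) ρ ⊓ hodgeOneZero hA)
    (P := (p : Module.End ℂ (complexBetti A.X 1))) (Q := (q : Module.End ℂ (complexBetti A.X 1)))
    (S := (s : Module.End ℂ (complexBetti A.X 1))) (T := (t : Module.End ℂ (complexBetti A.X 1)))
    (by rw [← Subalgebra.coe_add, hpq, Subalgebra.coe_one]) (by rw [← Subalgebra.coe_mul, hpp])
    (by rw [← Subalgebra.coe_mul, hts]) (by rw [← Subalgebra.coe_mul, hst]) (by rw [← Subalgebra.coe_mul, hpt])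
    (by rw [← Subalgebra.coe_mul, hps, Subalgebra.coe_zero]) (hstab p) (hstab s) (hstab t)
  exact this

/-- The same with `φ` CENTRAL in `End⁰(A)` (`End(A) ⊂ End⁰(A)` is injective, Mumford §19 Thm. 3 — the tree's
`endAlgebra.of_injective_of_charZero`). [cite: MumfordAV1970, §19 Thm. 3 and Cor. 2 of Thm. 1 (p. 174)] -/
theorem even_eigenMultiplicity_of_isSimple_of_finrank_le_eight_of_mem_center (hAs : A.IsSimple)
    (h8 : Module.finrank ℚ A.endAlgebra ≤ 8) (hZ : Subalgebra.center ℚ A.endAlgebra ≠ ⊤) {φ : A ⟶ A}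
    (hφZ : AbelianVariety.endAlgebra.of A φ ∈ Subalgebra.center ℚ A.endAlgebra) (ρ : ℂ) :
    Even (eigenMultiplicity A φ ρ) := by
  refine even_eigenMultiplicity_of_isSimple_of_finrank_le_eight hAs h8 hZ (fun ψ => ?_) ρ
  have h := (Subalgebra.mem_center_iff.1 hφZ) (AbelianVariety.endAlgebra.of A ψ)
  rw [← map_mul, ← map_mul] at h
  -- `ψ * φ = φ * ψ` in `End A`, i.e. `φ ≫ ψ = ψ ≫ φ`
  exact AbelianVariety.endAlgebra.of_injective_of_charZero (A := A) h

/-- **THE SHAPE OF CELL (γ).** On a SIMPLE complex abelian variety with `[End⁰(A):ℚ] = 8` and centre of degree `2`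
(a quaternion algebra over a quadratic field `k`) every multiplicity of a CENTRAL `φ` on `H^{1,0}(A)` is even — so `k`
never acts with multiplicities `(1,3)`. [cite: MoonenZarhin1999LowDim, §1 (1.1) and §5 (5.11) Case 2]
[cite: MumfordAV1970, §19 Cor. 2 of Thm. 1 (p. 174) and §21 (p. 202)] -/
theorem even_eigenMultiplicity_of_isSimple_of_finrank_eq_eight_of_finrank_center_eq_two (hAs : A.IsSimple)
    (h8 : Module.finrank ℚ A.endAlgebra = 8) (hZ2 : Module.finrank ℚ ↥(Subalgebra.center ℚ A.endAlgebra) = 2)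
    {φ : A ⟶ A} (hφZ : AbelianVariety.endAlgebra.of A φ ∈ Subalgebra.center ℚ A.endAlgebra) (ρ : ℂ) :
    Even (eigenMultiplicity A φ ρ) := by
  refine even_eigenMultiplicity_of_isSimple_of_finrank_le_eight_of_mem_center hAs h8.le (fun htop => ?_) hφZ ρ
  have h := hZ2
  rw [htop, (Subalgebra.topEquiv (R := ℚ) (A := A.endAlgebra)).toLinearEquiv.finrank_eq, h8] at h
  omega

end AbelianVariety

end Literature.AlgebraicGeometry.HodgeTheory.EndAlgebraDegreeEightEvenMultiplicity

end
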